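import Mathlib
import HarnessLib
import Summits.NavierStokesRegularity.NavierStokesRegularity.Theorems.WakeRatchetMinimalViscousBlowupSupLevelBootstrap

/-!
# Route `WakeRatchet`, crux `MinimalViscousBlowup` (stmt-NavierStokesRegularity-22743) — LINE g12-2 (ns-idea-1 g12, card «monotone quantity hunt»):
# RE-IGNITION, part 4/5 — the RISE TIME of a shell (level growth bound)

ns-idea-1 g12's kernel-checked file `lines/g12-2/Reignition.lean` (sha16 d946145192243467, 872 l.; evidence on ⟨22743⟩), landed VERBATIM by the
hand ns-qj-p1 g7 in five tree-sized files (decl texts byte-identical; only the module docstrings are split):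
`…ShellFence` (§1–§2) · `…UpperBlock` (§3) · `…Reignition` (§4) · `…LevelGrowth` (§5) · `…RetreatDepth` (§6).
MODEL lattice only (Tao's NS-scaled `ν`-viscous cascade lattice, `m = 4`; nothing about Navier–Stokes; no NS regularity statement is proved).
`--supports stmt-NavierStokesRegularity-22743 --as helper`.

* `level_growth_le` — under an envelope `λᵐ‖X_m‖² ≤ C` on a window, one shell's level grows at most linearly:
  `λⁿ‖X_n(t)‖² ≤ λⁿ‖X_n(s)‖² + 256·C·√C·λ^{2n}·(t − s)` (`|Π_m| ≤ 64 C√C λᵐ` under the envelope, `Π_{−1} = 0`), so re-lighting shell `n` from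
  level `≤ b/2` to level `b` takes time `≥ b λ^{−2n}/(512 C√C)`.  Independent of parts 1–3.
[cite: Tao2016AveragedNS, §4 (4.1)–(4.3), Lemma 4.1 (4.5), §5; BarbatoMorandinRomito2011, §3.1]
-/

noncomputable section

set_option linter.dupNamespace false

open Set Filter Topology
open Literature.Analysis.FluidPDE Literature.Analysis.FluidPDE.TaoCascade

namespace Summit.NavierStokesRegularity.NavierStokesRegularity.Theorems.MinimalViscousBlowup.ThresholdRay

/-! ### §5 The rise time of a shell -/

/-- **Level growth bound (rise time).**  Under an envelope `λᵐ‖X_m‖² ≤ C` on a window `[s,t] ⊂ [0,T')`, one shell's level grows at most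
linearly: `λⁿ‖X_n(t)‖² ≤ λⁿ‖X_n(s)‖² + 256·C·√C·λ^{2n}·(t − s)`, because `d/dt ½‖X_n‖² = Π_{n−1} − Π_n − (dissipation) ≤ |Π_{n−1}| + |Π_n| ≤
128 C√C λⁿ` (`|Π_m| ≤ 64 C√C λᵐ` under the envelope, `Π_{−1} = 0`).  So re-lighting shell `n` from level `≤ b/2` to level `b` takes time
`≥ b λ^{−2n}/(512 C√C)`. [cite: Tao2016AveragedNS, §4 (4.1)–(4.3)] -/
theorem level_growth_le {ε₀ ν T' C s t : ℝ} (hε : 0 < ε₀) (hC : 0 ≤ C)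
    {α : Fin 4 → Fin 4 → Fin 4 → ℤ × ℤ × ℤ → ℝ} (hcan : IsCancellingCoeff α)
    (hα1 : ∀ i₁ i₂ i₃, |α i₁ i₂ i₃ (0, 0, 1)| ≤ 1) {X : Fin 4 → ℤ → ℝ → ℝ}
    (hder : ∀ (i : Fin 4) (k : ℤ), ∀ t ∈ Icc 0 T', HasDerivWithinAt (X i k)
      (quadTerm ε₀ α X i k t - ν * (1 + ε₀) ^ ((2 : ℝ) * k) * X i k t) (Icc 0 T') t)
    (hlow : ∀ i n t, n < 0 → 0 ≤ t → X i n t = 0)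
    (henv : ∀ (m : ℕ) (τ : ℝ), τ ∈ Icc s t → (1 + ε₀) ^ m * ‖shellVec X m τ‖ ^ 2 ≤ C)
    (hs0 : 0 ≤ s) (hst : s ≤ t) (htT' : t < T') (hν0 : 0 ≤ ν) (n : ℕ) :
    (1 + ε₀) ^ n * ‖shellVec X n t‖ ^ 2 ≤
      (1 + ε₀) ^ n * ‖shellVec X n s‖ ^ 2 + 256 * C * Real.sqrt C * (1 + ε₀) ^ (2 * n) * (t - s) := by
  have hl0 : (0 : ℝ) < 1 + ε₀ := by linarith
  have hl1 : (1 : ℝ) < 1 + ε₀ := by linarith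
  have hCC : 0 ≤ 64 * C * Real.sqrt C := by positivity
  -- the shell-`n` energy and its derivative
  obtain ⟨G, hG⟩ : ∃ G : ℝ → ℝ,
      G = fun w => ∑ k ∈ Finset.Ico n (n + 1), ∑ i : Fin 4, (1 / 2 : ℝ) * X i k w ^ 2 := ⟨_, rfl⟩
  have hGeq : ∀ w, G w = 1 / 2 * ‖shellVec X n w‖ ^ 2 := by
    intro w
    rw [hG]
    simp only [Nat.Ico_succ_singleton, Finset.sum_singleton]
    rw [norm_shellVec_sq, Finset.mul_sum]
  obtain ⟨G', hG'⟩ : ∃ G' : ℝ → ℝ, G' = fun w => botSum ε₀ α X (((n : ℕ) : ℤ) - 1) w -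
      botSum ε₀ α X (((n + 1 : ℕ) : ℤ) - 1) w -
      ν * ∑ k ∈ Finset.Ico n (n + 1), (1 + ε₀) ^ ((2 : ℝ) * (k : ℤ)) * ∑ i : Fin 4, X i k w ^ 2 := ⟨_, rfl⟩
  have hG'eq : ∀ w, G' w = botSum ε₀ α X ((n : ℤ) - 1) w - botSum ε₀ α X n w -
      ν * (1 + ε₀) ^ (2 * n) * ‖shellVec X n w‖ ^ 2 := by
    intro w
    rw [hG']
    simp only [Nat.Ico_succ_singleton, Finset.sum_singleton]
    have hidx2 : (((n + 1 : ℕ) : ℤ) - 1) = (n : ℤ) := by push_cast; ring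
    have hw2 : (1 + ε₀) ^ ((2 : ℝ) * ((n : ℕ) : ℤ)) = (1 + ε₀) ^ (2 * n) := by
      rw [show (2 : ℝ) * (((n : ℕ) : ℤ) : ℝ) = ((2 * n : ℕ) : ℝ) by push_cast; ring, Real.rpow_natCast]
    rw [hidx2, hw2, norm_shellVec_sq]
    ring
  have hXc : ∀ (i : Fin 4) (k : ℤ), ContinuousOn (X i k) (Icc s t) := fun i k w hw =>
    ((hder i k w ⟨hs0.trans hw.1, hw.2.trans htT'.le⟩).continuousWithinAt).mono (Icc_subset_Icc hs0 htT'.le)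
  have hGc : ContinuousOn G (Icc s t) := by
    rw [hG]
    exact continuousOn_finsetSum _ fun k _ => continuousOn_finsetSum _ fun i _ =>
      continuousOn_const.mul ((hXc i k).pow 2)
  have hGder : ∀ w ∈ Ico s t, HasDerivWithinAt G (G' w) (Ici w) w := by
    intro w hw
    have hw0 : 0 ≤ w := hs0.trans hw.1
    have hwT' : w < T' := hw.2.trans htT'
    have h := hasDerivWithinAt_blockEnergy (ε₀ := ε₀) (ν := ν) hcan (fun i k => hder i k w ⟨hw0, hwT'.le⟩)
      (Nat.le_succ n)
    rw [hG, hG']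
    exact h.mono_of_mem_nhdsWithin (mem_of_superset (Icc_mem_nhdsGE hwT') (Icc_subset_Icc hw0 le_rfl))
  -- the derivative is at most `ρ = 128 C√C λⁿ`
  obtain ⟨ρ, hρ⟩ : ∃ ρ : ℝ, ρ = 128 * C * Real.sqrt C * (1 + ε₀) ^ n := ⟨_, rfl⟩
  have hbound : ∀ w ∈ Ico s t, G' w ≤ ρ := by
    intro w hw
    have hwI : w ∈ Icc s t := Ico_subset_Icc_self hw
    have hw0 : 0 ≤ w := hs0.trans hw.1
    have hout : |botSum ε₀ α X n w| ≤ 64 * C * Real.sqrt C * (1 + ε₀) ^ n :=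
      abs_botSum_le_of_levels hε hC hα1 X (henv n w hwI) (henv (n + 1) w hwI)
    have hin : |botSum ε₀ α X ((n : ℤ) - 1) w| ≤ 64 * C * Real.sqrt C * (1 + ε₀) ^ n := by
      cases n with
      | zero =>
        rw [show ((((0 : ℕ) : ℕ) : ℤ) - 1) = -1 by norm_num, botSum_neg_one_eq_zero hlow hw0, abs_zero]
        positivity
      | succ p =>
        have h := abs_botSum_le_of_levels hε hC hα1 X (henv p w hwI) (henv (p + 1) w hwI)
        rw [show (((p + 1 : ℕ) : ℤ) - 1) = (p : ℤ) by push_cast; ring]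
        exact h.trans (mul_le_mul_of_nonneg_left (pow_le_pow_right₀ hl1.le (Nat.le_succ p)) hCC)
    have hdis : 0 ≤ ν * (1 + ε₀) ^ (2 * n) * ‖shellVec X n w‖ ^ 2 := by positivity
    rw [hG'eq, hρ]
    linarith [le_abs_self (botSum ε₀ α X ((n : ℤ) - 1) w), neg_abs_le (botSum ε₀ α X n w)]
  -- comparison with the line `G s + ρ (w - s)`
  have hB' : ∀ w ∈ Ico s t, HasDerivWithinAt (fun w => G s + ρ * (w - s)) ρ (Ici w) w := by
    intro w _
    have h : HasDerivAt (fun w => G s + ρ * (w - s)) (ρ * 1) w :=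
      (((hasDerivAt_id w).sub_const s).const_mul ρ).const_add (G s)
    rw [mul_one] at h
    exact h.hasDerivWithinAt
  have hle := image_le_of_deriv_right_le_deriv_boundary hGc hGder (B := fun w => G s + ρ * (w - s)) (B' := fun _ => ρ)
    (by simp) (by fun_prop) hB' hbound (right_mem_Icc.2 hst)
  rw [hGeq, hGeq, hρ] at hle
  have hP : 0 ≤ (1 + ε₀) ^ n := pow_nonneg hl0.le n
  have := mul_le_mul_of_nonneg_left hle hP
  have e : (1 + ε₀) ^ (2 * n) = (1 + ε₀) ^ n * (1 + ε₀) ^ n := by rw [two_mul, pow_add]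
  rw [e]
  nlinarith [this]

end Summit.NavierStokesRegularity.NavierStokesRegularity.Theorems.MinimalViscousBlowup.ThresholdRay

end
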